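import Summits.QuantumFields.BalabanUV.T4Continuum.Support.NE9CurChartOneInstanceGaugeOrbit
import Literature.MathematicalPhysics.QuantumFieldTheory.Balaban1983to89.B9Eq335SmallBondsData

/-!
# NE9CurChartOneInstanceSmallBondsGaugeOrbit — THE ONE-INSTANCE CHART OF `cur V` ON ONE PAIR OF BALLS FOR EVERY BACKGROUND `V = U^g`
# GAUGE-EQUIVALENT, BY A UNIT-BOUNDED UNITARY GAUGE, TO A UNIT-BOUNDED SMALL-BOND FIELD OF A FIXED LATTICE: ne9-leaf-05's (SB-A)
# `Support/NE9CurChartOneInstanceSmallBonds` hosted on the gauge orbit (the BINDER-row OWNER t4-ne9-p1 g82's pointer W-ne9p1-g82-1, journal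
# l.43195: «the orbit leaf carries the three background binders {U1, ε, hRS∕unitary} instead of E162's five»); cell `pub-balaban`, T4-DAG §2 node
# U3 ∕ §6 NE9, route R2′; Summits-side NEW leaf under this seat's INTERFACE REQUEST NE9 (ruling e34b3e0c (0) — requested:
# `NE9CurChartOneInstanceSmallBondsGaugeOrbit.cur_chart_exists_oneInstance_gaugeOrbit_smallJ_of_small_bonds(_unitary)`), nothing printed asserted

HONEST FRAMING (T4-DAG PAGE 1).  Rung (B)+1 of the FINITE-VOLUME T⁴ programme — NOT infinite volume, NOT a mass gap, NOT the Clay problem.  NE9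
(`T4OutputRate.NE9` ∧ `FadingMemory`) is a cell NEW ESTIMATE, NOT PRINTED in [I] = [Balaban1987RG1] (CMP **109**), [II] = [Balaban1988RG2Cluster]
(CMP **116**), and NOT PROVED here («NE9 ⇐ the named binders»; spine PROVED 0∕9).  HONEST DEPENDENCY (cell line, verbatim): continuum YM on T⁴ ⇐
BetaPertH ∧ nine spine estimates (0/9 proved); BetaPertH ⇐ (D1) ∧ (D4) ∧ CAP+tail; G-an2-4 gates asym, D1 and NE2/3/4.  The `cur U` OBJECT is ONE
item of the MODEL O-NE9-1 (species (a) data); the END's `act` ∕ `ker` halves and NEEDS-COORDINATOR #5 are untouched.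

THE PRINT (loci only).  [Balaban1985BackgroundPropagators] p. 396 (3.35): the regularity class *«there exists a gauge transformation u on □ such that
U^u = e^{iηA}, |A| < …»*; (3.34): *«Δ_a(U^u) = R(u)Δ_a(U)R(u⁻¹), G(U^u) = R(u)G(U)R(u⁻¹)»*.  Here the small-bond gauge is GIVEN (binders at `U`),
the background of the conclusion is `V = U^g`; the construction «small plaquette variables ⇒ a gauge with small bond variables» ([I] (1.11)–(1.14)) is
NOT in this file.

WHAT THIS FILE PROVES (TWO theorems; 0 def, 0 sorry, axioms standard).  §1 **`cur_chart_exists_oneInstance_gaugeOrbit_smallJ_of_small_bonds`**: (SB-A)'s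
`∃ ε₃ ≤ ε_reg(d, L)`, `a_C ε_C a₃ C₄ ε₄ R_b R′`, `0 < j₁ ≤ M_J` (same numbers) such that for EVERY `U` with `U(b) ∈ U1`, `‖U(b) − 1‖ ≤ ε ≤ ε₃`, `hRS`,
EVERY gauge `g` with `g(x) ∈ U1`, `g(x)* = g(x)⁻¹`, `τ(R(g(x))X) = τ(X)`, `⟨R(g(x))v, R(g(x))v′⟩ = ⟨v, v′⟩`, the V₀-slot and all currents `‖J‖ ≤ j₁`,
`‖Δπ‖ ≤ M_Δ` read AT `U^g`: `hpos′(U^g)` HOLDS and `QuadAnalytic (W80 …) C₄ a₃ ∧ ‖𝔊(U^g) ∘L L_J‖ ≤ ½ ∧ (Ψ1)–(Ψ3)` for the one-instance chart of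
`cur (U^g)` on `ball 0 R_b → ball 0 R′` — E162's witnesses of `U` PRODUCED by `B9Eq335SmallBondsData` (`alpha_le_64/128`, `perCfg_mem_U1`,
`hreg_of_small_bonds`, `alphaL_le_half`) and those of `U^g` PRODUCED from them (`hU1_gaugeU`, `hreg_gaugeU` — `gaugeU` preserves NEITHER small-bond
binder, but it preserves E162's letters along U1-valued gauges).  §2 **`…_unitary`**: `hRS`, `hτ`-for-`g`, `hAd` DISCHARGED by the model letters
(unitary `U(b)` and `g(x)`, tracial `τ`, the norming `⟨φ⁻¹X, φ⁻¹Y⟩ = τ(X*Y)`) — background binders {`U(b) ∈ U1`, unitary, `‖U(b) − 1‖ ≤ ε ≤ ε₃`;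
`g(x) ∈ U1`, unitary} and nothing else.  MECHANISM: `NE9CurChartOneInstanceGaugeOrbit` §3 at the produced witnesses; one line each.
DISGUISE TEST: composition of landed theorems; no inequality of the series proved; per-LATTICE numbers — NOT print's uniformity in the lattice, NOT
(3.35)'s construction of the gauge, NOT p. 416's per-cube locality reduction; not NE9.
References (TYPES ∕ loci only): [Balaban1985Variational] (45)–(47) p. 285, Prop. 6 (117)–(121) p. 295, (172)–(175) p. 305;
[Balaban1985BackgroundPropagators] (3.28)–(3.35) pp. 395–396, Thm 3.11 p. 416; [Balaban1985Averaging] (18) p. 21, (42)–(45) pp. 23–24.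
Imports `Support/NE9CurChartOneInstanceGaugeOrbit` (this lineage, (G9)) and `B9Eq335SmallBondsData` (owner gen 82) ONLY; modifies nothing; no END
re-wired.  Value = route R2′ bookkeeping at rung (B)+1 (the species' chart on the gauge orbit of the small-bond class), NOT summit progress.
-/

noncomputable section

open Metric Set
open scoped InnerProductSpace

namespace Summit.QuantumFields.BalabanUV.T4Continuum.NE9CurChartOneInstanceSmallBondsGaugeOrbit

open Literature.MathematicalPhysics.QuantumFieldTheory.Balaban1983to89
open B11Eq103H1Complex B11Eq115Space B11Eq174Chart
open B11Eq111FrakG (nabla115)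
open B13Contraction113 (QuadAnalytic)
open B9Eq319QprimeTorus (fineP)
open B9SectCLatticeCarrier (Bond)
open B4Sect5Torus (TSite)
open B7Prop1Explicit (U1)
open B9Eq315QTorus (laplaceAofBackground)
open B9Eq315QTorusOnto (QtorusW_surjective)
open B9Eq310HessianOperator (adTransportW)
open B9Eq335SmallBondsData (perCfg_mem_U1 hreg_of_small_bonds alpha_le_128 alpha_le_64 alphaL_le_half epsReg_pos)
open B9Thm311SmallFieldClosed (hRS_of_unitary)
open B9Eq328GaugeAction (gaugeU AdA AdW tau_AdA_of_trace inner_AdW_AdW_of_compat)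
open B9Eq333ProjectionCovariance (hU1_gaugeU hreg_gaugeU)
open B11Eq44COperatorTorus (Cc)
open B11Eq80Current (W80)
open B11Eq79LinearTerm (LJ)
open B11Eq63V0GroupCurrent (curV0)
open Summit.QuantumFields.BalabanUV.T4Continuum.NE9CurChartOneInstanceGaugeOrbit (cur_chart_exists_oneInstance_gaugeOrbit_smallField_smallJ)

/-! ## §1 On the gauge orbit of the small-bond class: binders {`U1`, small bonds, `hRS`} at `U`, four displayed gauge binders -/

set_option maxRecDepth 8192 in
/-- **THE ONE-INSTANCE CHART OF `cur V` ON ONE PAIR OF BALLS FOR EVERY `V = U^g` GAUGE-EQUIVALENT (BY A UNIT-BOUNDED UNITARY GAUGE) TO A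
UNIT-BOUNDED SMALL-BOND BACKGROUND OF A FIXED LATTICE, ALL SMALL CURRENTS** — ne9-leaf-05's (SB-A) §1 with the conclusion's background `gaugeU g U`
(the OWNER's pointer W-ne9p1-g82-1: the orbit line hosted on the small-BOND class): background binders {`U(b) ∈ U1`, `‖U(b) − 1‖ ≤ ε ≤ ε₃`, `hRS`} AT
`U`, gauge binders {`g(x) ∈ U1`, unitary, `τ`-central, fibrewise isometric}; E162's five witnesses of `U` PRODUCED by `B9Eq335SmallBondsData` and those
of `U^g` PRODUCED from them by `B9Eq333ProjectionCovariance.hU1_gaugeU/hreg_gaugeU` (same `α = 2(d+1)Lε`; nothing displayed for `U^g`); the same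
`∃`-numbers as (SB-A); conclusion = `∃ hpos′ ∧ QuadAnalytic ∧ ‖𝔊(U^g) ∘L L_J‖ ≤ ½ ∧ (Ψ1)–(Ψ3)` at `∇_{U^g}`.  `NE9CurChartOneInstanceGaugeOrbit` §3 applied
at the produced witnesses.  NOT print's (3.35): the small-bond gauge is GIVEN here, not constructed from small plaquettes. [folklore] -/
theorem cur_chart_exists_oneInstance_gaugeOrbit_smallJ_of_small_bonds {d : ℕ} (L : ℕ) [NeZero L] (m : Fin d → ℕ) [∀ i, NeZero (fineP L m i)]
    (hL : 1 ≤ L)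
    {𝔸 : Type*} [NormedRing 𝔸] [NormedAlgebra ℂ 𝔸] [CompleteSpace 𝔸] [NormOneClass 𝔸] [StarRing 𝔸] [NormedStarGroup 𝔸] [StarModule ℂ 𝔸]
    [FiniteDimensional ℂ 𝔸]
    {W : Type*} [NormedAddCommGroup W] [InnerProductSpace ℂ W] [FiniteDimensional ℂ W] (φ : W ≃ₗ[ℂ] 𝔸) {Mφ Mφ' : ℝ} (hMφ : 0 ≤ Mφ)
    (hMφ' : 0 ≤ Mφ') (hφ : ∀ w, ‖φ w‖ ≤ Mφ * ‖w‖) (hφ' : ∀ X, ‖φ.symm X‖ ≤ Mφ' * ‖X‖)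
    (τ : 𝔸 →ₗ[ℂ] ℂ) {Cτ : ℝ} (hτ : ∀ X, ‖τ X‖ ≤ Cτ * ‖X‖) (hCτ : 0 ≤ Cτ)
    {η : ℝ} [Fact (0 < (L : ℝ))] [Fact (0 < η)] {lev₀ : Bond d (fineP L m) → ℕ} {levB : Bond d m → ℕ} (lev₁ : Bond d (fineP L m) × Fin d → ℕ)
    (hlev : ∀ b, 1 ≤ lev₀ b) {c₀ c₁ : ℝ} [Fact (0 < c₀)] [Fact (0 < c₁)] {a : ℝ} (ha : 0 < a)
    (ρ : (𝔸 →L[ℂ] ℂ) →L[ℂ] 𝔸) (τc : 𝔸 →L[ℂ] ℂ) {CV RV MJ MΔ : ℝ} (hCV : 0 ≤ CV) (hRV : 0 < RV) (hMJ : 0 < MJ) (hMΔ : 0 ≤ MΔ) :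
    ∃ ε₃ aC εC a₃ C₄ ε₄ Rb R' j₁ : ℝ, 0 < ε₃ ∧ ε₃ ≤ 1 / (256 * ((d : ℝ) + 1) ^ 2 * (L : ℝ) ^ (d + 1)) ∧
      0 < aC ∧ 0 < εC ∧ 0 < a₃ ∧ 0 ≤ C₄ ∧ 0 < ε₄ ∧ 0 < Rb ∧ 0 < R' ∧ 0 < j₁ ∧ j₁ ≤ MJ ∧
      ∀ (U : Bond d (fineP L m) → 𝔸ˣ) (hU : ∀ b, U b ∈ U1 𝔸) {ε : ℝ} (hε : 0 ≤ ε)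
        (hεr : ε ≤ 1 / (256 * ((d : ℝ) + 1) ^ 2 * (L : ℝ) ^ (d + 1))), ε ≤ ε₃ → ∀ (hUε : ∀ b, ‖(U b : 𝔸) - 1‖ ≤ ε),
        (∀ (b : Bond d (fineP L m)) (v u : W), inner ℂ (adTransportW φ U b v) u = inner ℂ v (adTransportW φ (fun b => (U b)⁻¹) b u)) →
      ∀ {g : TSite d (fineP L m) → 𝔸ˣ} (hg : ∀ x, g x ∈ U1 𝔸), (∀ x, star (g x : 𝔸) = ((g x)⁻¹ : 𝔸ˣ)) →
        (∀ (x : TSite d (fineP L m)) (X : 𝔸), τ (AdA (g x) X) = τ X) →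
        (∀ (x : TSite d (fineP L m)) (v v' : W), inner ℂ (AdW φ (g x) v) (AdW φ (g x) v') = inner ℂ v v') →
        (∀ Y : Space115 (L : ℝ) η lev₀ lev₁ (nabla115 η (gaugeU g U)), ‖Y‖ < RV →
          ‖curV0 (lev₁ := lev₁) (Dc := nabla115 η (gaugeU g U)) ρ τc (gaugeU g U) Y‖ ≤ CV * ‖Y‖ ^ 2) →
      ∀ (J : NegSize (L : ℝ) η lev₀ 3 𝔸) (Δπ : Space115 (L : ℝ) η lev₀ lev₁ (nabla115 η (gaugeU g U)) →L[ℂ] NegSize (L : ℝ) η lev₀ 3 𝔸),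
        ‖J‖ ≤ j₁ → ‖Δπ‖ ≤ MΔ →
      ∃ hpos : ∀ x : BondL2K ℂ d (fineP L m) c₀ W, x ≠ 0 →
          0 < RCLike.re (inner ℂ x (laplaceAofBackground L m hL φ (gaugeU g U) (alpha_le_64 hL hε hεr)
            (hU1_gaugeU L m g U hg (perCfg_mem_U1 L m hU)) (hreg_gaugeU L m g U hg (hreg_of_small_bonds L m hU hε hUε)) τ η (c₀ := c₀) (c₁ := c₁) a x)),
      let Hc := H1LatticeCLM (lev₀ := lev₀) (levB := levB) φ hpos (QtorusW_surjective L m hL (gaugeU g U) (alpha_le_64 hL hε hεr)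
        (hU1_gaugeU L m g U hg (perCfg_mem_U1 L m hU)) (hreg_gaugeU L m g U hg (hreg_of_small_bonds L m hU hε hUε)) (alphaL_le_half hL hεr) φ) lev₁ (nabla115 η (gaugeU g U))
      let Gc := frakGLatticeCLM (lev₀ := lev₀) φ hpos (QtorusW_surjective L m hL (gaugeU g U) (alpha_le_64 hL hε hεr)
        (hU1_gaugeU L m g U hg (perCfg_mem_U1 L m hU)) (hreg_gaugeU L m g U hg (hreg_of_small_bonds L m hU hε hUε)) (alphaL_le_half hL hεr) φ) lev₁ (nabla115 η (gaugeU g U))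
      let Cx := Cc L m η (gaugeU g U) lev₀ lev₁ (nabla115 η (gaugeU g U)) levB
      QuadAnalytic (W80 ρ τc (gaugeU g U) Hc Cx εC J Δπ) C₄ a₃ ∧ ‖Gc.comp (LJ ρ τc Hc Cx J)‖ ≤ 1 / 2 ∧
      DifferentiableOn ℂ (chartHB Gc (-(Gc.comp (LJ ρ τc Hc Cx J))) (W80 ρ τc (gaugeU g U) Hc Cx εC J Δπ) 0
          (fun A' => A' + solA Hc 0 Cx 0 εC A') ε₄ Hc) (ball (0 : NegSize (L : ℝ) η levB 0 𝔸) Rb) ∧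
      MapsTo (chartHB Gc (-(Gc.comp (LJ ρ τc Hc Cx J))) (W80 ρ τc (gaugeU g U) Hc Cx εC J Δπ) 0
          (fun A' => A' + solA Hc 0 Cx 0 εC A') ε₄ Hc) (ball (0 : NegSize (L : ℝ) η levB 0 𝔸) Rb)
          (ball (0 : Space115 (L : ℝ) η lev₀ lev₁ (nabla115 η (gaugeU g U))) R') ∧
      chartHB Gc (-(Gc.comp (LJ ρ τc Hc Cx J))) (W80 ρ τc (gaugeU g U) Hc Cx εC J Δπ) 0
          (fun A' => A' + solA Hc 0 Cx 0 εC A') ε₄ Hc 0 = 0 := by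
  obtain ⟨ε₃, aC, εC, a₃, C₄, ε₄, Rb, R', j₁, hε₃, haC, hεC, ha₃, hC₄, hε₄, hRb, hR', hj₁, hj₁M, H⟩ :=
    cur_chart_exists_oneInstance_gaugeOrbit_smallField_smallJ L m hL φ hMφ hMφ' hφ hφ' τ hτ hCτ (η := η) (lev₀ := lev₀) (levB := levB) lev₁
      hlev (c₀ := c₀) (c₁ := c₁) ha ρ τc hCV hRV hMJ hMΔ
  refine ⟨min ε₃ (1 / (256 * ((d : ℝ) + 1) ^ 2 * (L : ℝ) ^ (d + 1))), aC, εC, a₃, C₄, ε₄, Rb, R', j₁, lt_min hε₃ (epsReg_pos hL),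
    min_le_right _ _, haC, hεC, ha₃, hC₄, hε₄, hRb, hR', hj₁, hj₁M, ?_⟩
  intro U hU ε hε hεr hεm hUε hRS g hg hstar hτg hAd hqV J Δπ hJ hΔ
  exact H U (alpha_le_128 hL hε hεr) (alpha_le_64 hL hε hεr) (perCfg_mem_U1 L m hU) (hreg_of_small_bonds L m hU hε hUε)
    (alphaL_le_half hL hεr) hε (hεm.trans (min_le_left _ _)) hUε hRS hg hstar hτg hAd (hU1_gaugeU L m g U hg (perCfg_mem_U1 L m hU))
    (hreg_gaugeU L m g U hg (hreg_of_small_bonds L m hU hε hUε)) hqV J Δπ hJ hΔ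

/-! ## §2 The same with `hRS`, `hτ`, `hAd` discharged by the model letters (unitary `U` and `g`, tracial `τ`, the norming) -/

set_option maxRecDepth 8192 in
/-- **THE SAME WITH `hRS`, `hτ`-FOR-`g` AND `hAd` DISCHARGED BY THE MODEL LETTERS** (unitary bond variables and gauge, tracial `τ`, the norming
`⟨φ⁻¹X, φ⁻¹Y⟩ = τ(X*Y)`: `B9Thm311SmallFieldClosed.hRS_of_unitary`, `B9Eq328GaugeAction.tau_AdA_of_trace`, `B9Eq328GaugeAction.inner_AdW_AdW_of_compat`):
for EVERY unit-bounded unitary small-bond `U` of a fixed lattice and EVERY unit-bounded unitary gauge `g` — binders {`U(b) ∈ U1`, `U(b)* = U(b)⁻¹`,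
`‖U(b) − 1‖ ≤ ε ≤ ε₃`, `g(x) ∈ U1`, `g(x)* = g(x)⁻¹`} and nothing else displayed about the background — the one-instance chart of `cur (U^g)` satisfies
`hpos′ ∧ QuadAnalytic ∧ ‖𝔊(U^g) ∘L L_J‖ ≤ ½ ∧ (Ψ1)–(Ψ3)` on ONE pair of balls for all small currents. [folklore] -/
theorem cur_chart_exists_oneInstance_gaugeOrbit_smallJ_of_small_bonds_unitary {d : ℕ} (L : ℕ) [NeZero L] (m : Fin d → ℕ) [∀ i, NeZero (fineP L m i)]
    (hL : 1 ≤ L)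
    {𝔸 : Type*} [NormedRing 𝔸] [NormedAlgebra ℂ 𝔸] [CompleteSpace 𝔸] [NormOneClass 𝔸] [StarRing 𝔸] [NormedStarGroup 𝔸] [StarModule ℂ 𝔸]
    [FiniteDimensional ℂ 𝔸]
    {W : Type*} [NormedAddCommGroup W] [InnerProductSpace ℂ W] [FiniteDimensional ℂ W] (φ : W ≃ₗ[ℂ] 𝔸) {Mφ Mφ' : ℝ} (hMφ : 0 ≤ Mφ)
    (hMφ' : 0 ≤ Mφ') (hφ : ∀ w, ‖φ w‖ ≤ Mφ * ‖w‖) (hφ' : ∀ X, ‖φ.symm X‖ ≤ Mφ' * ‖X‖)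
    (τ : 𝔸 →ₗ[ℂ] ℂ) {Cτ : ℝ} (hτ : ∀ X, ‖τ X‖ ≤ Cτ * ‖X‖) (hCτ : 0 ≤ Cτ)
    (hτφ : ∀ X Y : 𝔸, inner ℂ (φ.symm X) (φ.symm Y) = τ (star X * Y)) (htr : ∀ X Y : 𝔸, τ (X * Y) = τ (Y * X))
    {η : ℝ} [Fact (0 < (L : ℝ))] [Fact (0 < η)] {lev₀ : Bond d (fineP L m) → ℕ} {levB : Bond d m → ℕ} (lev₁ : Bond d (fineP L m) × Fin d → ℕ)
    (hlev : ∀ b, 1 ≤ lev₀ b) {c₀ c₁ : ℝ} [Fact (0 < c₀)] [Fact (0 < c₁)] {a : ℝ} (ha : 0 < a)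
    (ρ : (𝔸 →L[ℂ] ℂ) →L[ℂ] 𝔸) (τc : 𝔸 →L[ℂ] ℂ) {CV RV MJ MΔ : ℝ} (hCV : 0 ≤ CV) (hRV : 0 < RV) (hMJ : 0 < MJ) (hMΔ : 0 ≤ MΔ) :
    ∃ ε₃ aC εC a₃ C₄ ε₄ Rb R' j₁ : ℝ, 0 < ε₃ ∧ ε₃ ≤ 1 / (256 * ((d : ℝ) + 1) ^ 2 * (L : ℝ) ^ (d + 1)) ∧
      0 < aC ∧ 0 < εC ∧ 0 < a₃ ∧ 0 ≤ C₄ ∧ 0 < ε₄ ∧ 0 < Rb ∧ 0 < R' ∧ 0 < j₁ ∧ j₁ ≤ MJ ∧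
      ∀ (U : Bond d (fineP L m) → 𝔸ˣ) (hU : ∀ b, U b ∈ U1 𝔸) {ε : ℝ} (hε : 0 ≤ ε)
        (hεr : ε ≤ 1 / (256 * ((d : ℝ) + 1) ^ 2 * (L : ℝ) ^ (d + 1))), ε ≤ ε₃ → ∀ (hUε : ∀ b, ‖(U b : 𝔸) - 1‖ ≤ ε),
        (∀ b, star (U b : 𝔸) = (((U b)⁻¹ : 𝔸ˣ) : 𝔸)) →
      ∀ {g : TSite d (fineP L m) → 𝔸ˣ} (hg : ∀ x, g x ∈ U1 𝔸), (∀ x, star (g x : 𝔸) = ((g x)⁻¹ : 𝔸ˣ)) →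
        (∀ Y : Space115 (L : ℝ) η lev₀ lev₁ (nabla115 η (gaugeU g U)), ‖Y‖ < RV →
          ‖curV0 (lev₁ := lev₁) (Dc := nabla115 η (gaugeU g U)) ρ τc (gaugeU g U) Y‖ ≤ CV * ‖Y‖ ^ 2) →
      ∀ (J : NegSize (L : ℝ) η lev₀ 3 𝔸) (Δπ : Space115 (L : ℝ) η lev₀ lev₁ (nabla115 η (gaugeU g U)) →L[ℂ] NegSize (L : ℝ) η lev₀ 3 𝔸),
        ‖J‖ ≤ j₁ → ‖Δπ‖ ≤ MΔ →
      ∃ hpos : ∀ x : BondL2K ℂ d (fineP L m) c₀ W, x ≠ 0 →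
          0 < RCLike.re (inner ℂ x (laplaceAofBackground L m hL φ (gaugeU g U) (alpha_le_64 hL hε hεr)
            (hU1_gaugeU L m g U hg (perCfg_mem_U1 L m hU)) (hreg_gaugeU L m g U hg (hreg_of_small_bonds L m hU hε hUε)) τ η (c₀ := c₀) (c₁ := c₁) a x)),
      let Hc := H1LatticeCLM (lev₀ := lev₀) (levB := levB) φ hpos (QtorusW_surjective L m hL (gaugeU g U) (alpha_le_64 hL hε hεr)
        (hU1_gaugeU L m g U hg (perCfg_mem_U1 L m hU)) (hreg_gaugeU L m g U hg (hreg_of_small_bonds L m hU hε hUε)) (alphaL_le_half hL hεr) φ) lev₁ (nabla115 η (gaugeU g U))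
      let Gc := frakGLatticeCLM (lev₀ := lev₀) φ hpos (QtorusW_surjective L m hL (gaugeU g U) (alpha_le_64 hL hε hεr)
        (hU1_gaugeU L m g U hg (perCfg_mem_U1 L m hU)) (hreg_gaugeU L m g U hg (hreg_of_small_bonds L m hU hε hUε)) (alphaL_le_half hL hεr) φ) lev₁ (nabla115 η (gaugeU g U))
      let Cx := Cc L m η (gaugeU g U) lev₀ lev₁ (nabla115 η (gaugeU g U)) levB
      QuadAnalytic (W80 ρ τc (gaugeU g U) Hc Cx εC J Δπ) C₄ a₃ ∧ ‖Gc.comp (LJ ρ τc Hc Cx J)‖ ≤ 1 / 2 ∧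
      DifferentiableOn ℂ (chartHB Gc (-(Gc.comp (LJ ρ τc Hc Cx J))) (W80 ρ τc (gaugeU g U) Hc Cx εC J Δπ) 0
          (fun A' => A' + solA Hc 0 Cx 0 εC A') ε₄ Hc) (ball (0 : NegSize (L : ℝ) η levB 0 𝔸) Rb) ∧
      MapsTo (chartHB Gc (-(Gc.comp (LJ ρ τc Hc Cx J))) (W80 ρ τc (gaugeU g U) Hc Cx εC J Δπ) 0
          (fun A' => A' + solA Hc 0 Cx 0 εC A') ε₄ Hc) (ball (0 : NegSize (L : ℝ) η levB 0 𝔸) Rb)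
          (ball (0 : Space115 (L : ℝ) η lev₀ lev₁ (nabla115 η (gaugeU g U))) R') ∧
      chartHB Gc (-(Gc.comp (LJ ρ τc Hc Cx J))) (W80 ρ τc (gaugeU g U) Hc Cx εC J Δπ) 0
          (fun A' => A' + solA Hc 0 Cx 0 εC A') ε₄ Hc 0 = 0 := by
  obtain ⟨ε₃, aC, εC, a₃, C₄, ε₄, Rb, R', j₁, hε₃, hle, haC, hεC, ha₃, hC₄, hε₄, hRb, hR', hj₁, hj₁M, H⟩ :=
    cur_chart_exists_oneInstance_gaugeOrbit_smallJ_of_small_bonds L m hL φ hMφ hMφ' hφ hφ' τ hτ hCτ (η := η) (lev₀ := lev₀) (levB := levB) lev₁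
      hlev (c₀ := c₀) (c₁ := c₁) ha ρ τc hCV hRV hMJ hMΔ
  refine ⟨ε₃, aC, εC, a₃, C₄, ε₄, Rb, R', j₁, hε₃, hle, haC, hεC, ha₃, hC₄, hε₄, hRb, hR', hj₁, hj₁M, ?_⟩
  intro U hU ε hε hεr hεm hUε hUstar g hg hgstar hqV J Δπ hJ hΔ
  have hτg : ∀ (x : TSite d (fineP L m)) (X : 𝔸), τ (AdA (g x) X) = τ X := fun x X => tau_AdA_of_trace τ htr (g x) X
  exact H U hU hε hεr hεm hUε (hRS_of_unitary φ τ hτφ htr U hUstar) hg hgstar hτg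
    (fun x v v' => inner_AdW_AdW_of_compat φ τ hτφ (hτg x) (hgstar x) v v') hqV J Δπ hJ hΔ

end Summit.QuantumFields.BalabanUV.T4Continuum.NE9CurChartOneInstanceSmallBondsGaugeOrbit

end
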